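import Literature.Analysis.FluidPDE.StationaryEulerSubsolutions
import Literature.Analysis.FunctionSpaces.TorusCellwiseHNegOneVector
import HarnessLib

/-!
# The perturbation step on the torus (Choffrut–Székelyhidi 2014, §2, Step 3)

Topic `Literature/Analysis/FluidPDE`. Support file of the proof of
`Literature.Analysis.FluidPDE.Torus.ChoffrutSzekelyhidi2014_thm1` (Choffrut–Székelyhidi, SIAM
J. Math. Anal. 46 (2014) = arXiv:1401.4301). **Step 3 of §2** ("property (P) with an easy
covering and rescaling argument"), in the explicit form used by the iteration: for `w ∈ X₀`,
finitely many continuous test fields `p_a` and `ε > 0` there is a smooth weak subsolution `W`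
(a grid field) with

* `w + W ∈ X₀` pointwise (`w(x) + W(x) ∈ 𝒰_{e(x)}`),
* `|∫ ⟪W, p_a⟫| ≤ ε` for all `a` (near-orthogonality, from the cellwise mean zero),
* `‖v-part of W‖_{H⁻¹} ≤ ε` (cellwise `H⁻¹` bound),
* `∫ ‖W‖² ≥ J(w) - ε` where `J(w) = ∫ (e - |v|²)` is the defect (laminate gain, Cor. 16, realised
  by Prop. 6 and re-boxed into the cells of a fine grid).

The pointwise data (laminate, packet, joint margin) are chosen at every point, a finite subcover
of the torus and its Lebesgue number (pulled back to the fundamental cube) fix a finite family of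
reference packets and their common sup bound `M`, and only then is the mesh chosen.

## References

* A. Choffrut, L. Székelyhidi Jr., SIAM J. Math. Anal. 46 (2014), §2, Step 3; Prop. 6; Cor. 16.
-/

noncomputable section

open scoped InnerProductSpace ContDiff ENNReal
open Set Function MeasureTheory Metric
open Literature.Analysis.FunctionSpaces

namespace Literature.Analysis.FluidPDE

namespace StationaryEuler

variable {d : Type*} [Fintype d] [DecidableEq d] [Nonempty d]

/-! ## Pointwise data -/

/-- **Pointwise perturbation data** at a point `x₀` of an `X₀` field: a packet supported in the axis
cube whose values keep `w(x₀)` in `𝒰_{e(x₀)}` with a uniform joint margin `δ`, and whose energy is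
at least `e(x₀) - |v(x₀)|² - η` (laminate of Prop. 15 (iii)/Lemma 6, realised by Prop. 6, re-boxed).
[cite: ChoffrutSzekelyhidi2014, §2, Step 3; Cor. 16] -/
theorem exists_pointData (𝓕 : RelaxedFamily d) {e : UnitAddTorus d → ℝ} {w : UnitAddTorus d → State d}
    (hw : MemX0 𝓕 e w) {η : ℝ} (hη : 0 < η) (x₀ : UnitAddTorus d) :
    ∃ (P : Packet d) (δ : ℝ), 0 < δ ∧ Packet.SuppIn (box d) P ∧
      (∀ r' w', |r' - e x₀| < δ → IsAdm w' → ∀ y, dist w' (w x₀ + Packet.field P y) < δ → w' ∈ 𝓕.U r') ∧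
      (∀ r' w', |r' - e x₀| < δ → IsAdm w' → dist w' (w x₀) < δ → w' ∈ 𝓕.U r') ∧
      e x₀ - ‖vel (w x₀)‖ ^ 2 - η ≤ ∫ y, ‖Packet.field P y‖ ^ 2 := by
  have hη3 : 0 < η / 3 := by positivity
  obtain ⟨r', -, -, -, T, hT, hbary, -, hgain⟩ := 𝓕.exists_laminate_var_ge (hw.mem x₀) hη3
  obtain ⟨i₀⟩ := ‹Nonempty d›
  obtain ⟨P, hPsupp, hPU, hPgain⟩ := realize i₀ (𝓕.isRelOpen (e x₀)) (fun w hw => 𝓕.isAdm_of_mem hw) T hT hη3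
  obtain ⟨P', hP'supp, hP'vals, hP'gain⟩ := exists_boxed (T.frame i₀) hPsupp hη3
  -- the compact set of values and its joint margin
  set S : Set (State d) := insert (w x₀) (range fun y => w x₀ + Packet.field P' y) with hS
  have hrange : (range fun y => w x₀ + Packet.field P' y) = (fun z => w x₀ + z) '' range (Packet.field P') :=
    Set.range_comp (fun z => w x₀ + z) (Packet.field P')
  have hSc : IsCompact S := by
    rw [hS, hrange]
    exact ((isCompact_range_field P').image (continuous_const.add continuous_id)).insert (w x₀)
  have hSU : S ⊆ 𝓕.U (e x₀) := by
    rintro s (rfl | ⟨y, rfl⟩)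
    · exact hw.mem x₀
    · show w x₀ + Packet.field P' y ∈ 𝓕.U (e x₀)
      rcases hP'vals y with h0 | ⟨z, hz⟩
      · rw [h0, add_zero]; exact hw.mem x₀
      · rw [hz, ← hbary]; exact hPU z
  obtain ⟨δ, hδ, hmarg⟩ := 𝓕.exists_jmargin hSc hSU
  refine ⟨P', δ, hδ, hP'supp, fun r' w' hr hw' y hd => hmarg _ (mem_insert_of_mem _ ⟨y, rfl⟩) r' w' hr hw' hd,
    fun r' w' hr hw' hd => hmarg _ (mem_insert _ _) r' w' hr hw' hd, ?_⟩
  rw [hbary] at hPgain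
  linarith

/-! ## The step -/

omit [DecidableEq d] [Nonempty d] in
/-- A finite family of bounded functions has a common bound. [folklore] -/
theorem exists_common_bound {ι : Type*} (t : Finset ι) (B : ι → ℝ) :
    ∃ M : ℝ, 0 ≤ M ∧ ∀ a ∈ t, B a ≤ M := by
  classical
  refine ⟨∑ a ∈ t, |B a|, Finset.sum_nonneg fun a _ => abs_nonneg _, fun a ha => ?_⟩
  exact (le_abs_self _).trans (Finset.single_le_sum (fun b _ => abs_nonneg (B b)) ha)

omit [DecidableEq d] [Nonempty d] in
/-- The corner `κ/m` of the cell `κ` lies in the (half-open) cell. [folklore] -/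
theorem corner_mem_latticeCell {m : ℕ} (hm : 0 < m) (κ : d → Fin m) :
    corner frame0 m (gridIdx κ) ∈ Torus.latticeCell m (gridIdx κ) := by
  have hm' : (0 : ℝ) < m := by exact_mod_cast hm
  intro i
  have hc : (corner frame0 m (gridIdx κ)) i = ((gridIdx κ i : ℤ) : ℝ) / m := rfl
  rw [hc]
  exact ⟨le_rfl, by rw [add_div]; linarith [one_div_pos.2 hm']⟩

omit [DecidableEq d] [Nonempty d] in
/-- `√d` as an extended real power. [folklore] -/
theorem card_rpow_half : (Fintype.card d : ℝ≥0∞) ^ (1 / 2 : ℝ) = ENNReal.ofReal (Real.sqrt (Fintype.card d)) := by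
  rw [← ENNReal.ofReal_natCast, ENNReal.ofReal_rpow_of_nonneg (Nat.cast_nonneg _) (by norm_num), Real.sqrt_eq_rpow]

/-- **The perturbation step** (§2, Step 3 of the paper, explicit form). For `w ∈ X₀`, finitely many
continuous test fields `p_a` and `ε > 0` there is a smooth weak subsolution `W` with `w + W ∈ X₀`
pointwise, `|∫ ⟪W, p_a⟫| ≤ ε`, `‖v(W)‖_{H⁻¹} ≤ ε` and `∫ ‖W‖² ≥ J(w) - ε`.
[cite: ChoffrutSzekelyhidi2014, §2, Step 3] -/
theorem step (𝓕 : RelaxedFamily d) {e : UnitAddTorus d → ℝ} (he : Continuous e) {w : UnitAddTorus d → State d}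
    (hw : MemX0 𝓕 e w) {N : ℕ} (p : Fin N → UnitAddTorus d → State d) (hp : ∀ a, Continuous (p a)) {ε : ℝ} (hε : 0 < ε) :
    ∃ W : UnitAddTorus d → State d, Torus.IsSmooth W ∧ IsTorusSub W ∧ (∀ x, w x + W x ∈ 𝓕.U (e x)) ∧
      (∀ a, |∫ x, ⟪W x, p a x⟫_ℝ| ≤ ε) ∧
      Torus.eSobolevNorm (-1) (EuclideanSpace.complexify ∘ fun x => vel (W x)) ≤ ENNReal.ofReal ε ∧
      defect e w - ε ≤ ∫ x, ‖W x‖ ^ 2 := by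
  have hε4 : 0 < ε / 4 := by positivity
  -- Step 1: pointwise data
  choose Pk δk hδk hPk_supp hPk_marg hPk_marg0 hPk_gain using fun x₀ => exists_pointData 𝓕 hw hε4 x₀
  -- the defect density
  set g : UnitAddTorus d → ℝ := fun x => e x - ‖vel (w x)‖ ^ 2 with hg
  have hwc : Continuous w := hw.continuous
  have hgc : Continuous g := he.sub ((continuous_norm.comp ((continuous_vel).comp hwc)).pow 2)
  -- Step 2: the open cover of the torus and a finite subcover
  set O : UnitAddTorus d → Set (UnitAddTorus d) := fun a =>
    {x | |e x - e a| < δk a / 2 ∧ dist (w x) (w a) < δk a / 2 ∧ |g x - g a| < ε / 4} with hO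
  have hOo : ∀ a, IsOpen (O a) := fun a =>
    IsOpen.inter (isOpen_lt (continuous_abs.comp (he.sub continuous_const)) continuous_const)
      (IsOpen.inter (isOpen_lt (hwc.dist continuous_const) continuous_const)
        (isOpen_lt (continuous_abs.comp (hgc.sub continuous_const)) continuous_const))
  have hOmem : ∀ a, a ∈ O a := fun a => by
    simp only [hO, mem_setOf_eq, sub_self, abs_zero, dist_self]
    exact ⟨half_pos (hδk a), half_pos (hδk a), hε4⟩
  obtain ⟨t, ht⟩ := isCompact_univ.elim_finite_subcover O hOo fun x _ => mem_iUnion.2 ⟨x, hOmem x⟩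
  -- common bound of the finitely many reference fields
  have hbd : ∀ a, ∃ B, ∀ y, ‖Packet.field (Pk a) y‖ ≤ B := fun a => by
    obtain ⟨B, hB⟩ := (isCompact_range_field (Pk a)).isBounded.exists_norm_le
    exact ⟨B, fun y => hB _ ⟨y, rfl⟩⟩
  choose B hB using hbd
  obtain ⟨M, hM0, hM⟩ := exists_common_bound t B
  have hMt : ∀ a ∈ t, ∀ y, ‖Packet.field (Pk a) y‖ ≤ M := fun a ha y => (hB a y).trans (hM a ha)
  -- Step 3: Lebesgue number of the pulled-back cover on the closed ball containing the cube
  set Kb : Set (Ed d) := closedBall (0 : Ed d) (Fintype.card d) with hKb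
  have hKc : IsCompact Kb := isCompact_closedBall _ _
  obtain ⟨lam, hlam, hleb⟩ := lebesgue_number_lemma_of_metric hKc (c := fun a : t => Torus.proj ⁻¹' O a)
    (fun a => (hOo a).preimage Torus.continuous_proj) (fun y _ => by
      have := ht (mem_univ (Torus.proj y))
      simp only [mem_iUnion] at this
      obtain ⟨a, ha, hya⟩ := this
      exact mem_iUnion.2 ⟨⟨a, ha⟩, hya⟩)
  obtain ⟨x₀⟩ : Nonempty (UnitAddTorus d) := inferInstance
  obtain ⟨a₀, ha₀⟩ : ∃ a, a ∈ t := by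
    have := ht (mem_univ x₀)
    simp only [mem_iUnion] at this
    obtain ⟨a, ha, -⟩ := this
    exact ⟨a, ha⟩
  haveI : Nonempty t := ⟨⟨a₀, ha₀⟩⟩
  choose! sel hsel using hleb
  -- Step 4: the mesh
  -- (a) Lebesgue: `√d / m < lam`
  obtain ⟨m₁, hm₁⟩ := exists_nat_gt (Real.sqrt (Fintype.card d) / lam)
  -- (b) oscillation of the test fields
  set η : ℝ := ε / (Fintype.card (Idx d) * M + 1) with hη
  have hη0 : 0 < η := by positivity
  have hosc : ∀ ac : Fin N × Idx d, ∃ m₀ : ℕ, 0 < m₀ ∧ ∀ m : ℕ, m₀ ≤ m → ∀ κ : d → Fin m,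
      ∀ y ∈ Torus.latticeCell m (gridIdx κ), ∀ y' ∈ Torus.latticeCell m (gridIdx κ),
        |p ac.1 (Torus.proj y) ac.2 - p ac.1 (Torus.proj y') ac.2| ≤ η := fun ac =>
    exists_mesh_osc_le ((PiLp.continuous_apply 2 (fun _ : Idx d => ℝ) ac.2).comp (hp ac.1)) hη0
  choose m₂ hm₂pos hm₂ using hosc
  -- (c) the `H⁻¹` constant
  have hCd0 : 0 ≤ 2 * Real.pi * Real.sqrt (Fintype.card d) * 2 ^ ((Fintype.card d : ℝ) / 2) := by positivity
  obtain ⟨m₃, hm₃⟩ := exists_nat_gt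
    (Real.sqrt (Fintype.card d) * (2 * Real.pi * Real.sqrt (Fintype.card d) * 2 ^ ((Fintype.card d : ℝ) / 2)) * M / ε)
  set m : ℕ := m₁ + (Finset.univ.sup m₂) + m₃ + 1 with hmdef
  have hm : 0 < m := by positivity
  have hm' : (0 : ℝ) < m := by exact_mod_cast hm
  have hm_ge₁ : m₁ ≤ m := by omega
  have hm_ge₂ : ∀ ac, m₂ ac ≤ m := fun ac => by
    have : m₂ ac ≤ Finset.univ.sup m₂ := Finset.le_sup (Finset.mem_univ ac)
    omega
  have hm_ge₃ : m₃ ≤ m := by omega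
  have hmesh : Real.sqrt (Fintype.card d) / m < lam := by
    have h1 : Real.sqrt (Fintype.card d) / lam < m := lt_of_lt_of_le hm₁ (by exact_mod_cast hm_ge₁)
    rw [div_lt_iff₀ hlam] at h1
    rw [div_lt_iff₀ hm']; linarith
  -- Step 5: the reference packets of the cells and the increment
  set Q : (d → ℤ) → Packet d := fun κ => Pk (sel (corner frame0 m κ)) with hQ
  have hQsupp : ∀ κ, Packet.SuppIn (box d) (Q κ) := fun κ => hPk_supp _
  -- cells are small: the cell `κ` is mapped into `O (sel (corner κ))`, and `sel (corner κ) ∈ t`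
  have hcorner : ∀ κ : d → Fin m, corner frame0 m (gridIdx κ) ∈ Kb := fun κ =>
    Torus.unitCube_subset_closedBall (Torus.latticeCell_subset_unitCube hm κ (corner_mem_latticeCell hm κ))
  have hsel_t : ∀ κ : d → Fin m, (sel (corner frame0 m (gridIdx κ)) : UnitAddTorus d) ∈ t := fun κ =>
    (sel (corner frame0 m (gridIdx κ))).2
  have hcellO : ∀ κ : d → Fin m, ∀ y ∈ Torus.latticeCell m (gridIdx κ),
      Torus.proj y ∈ O (sel (corner frame0 m (gridIdx κ))) := by
    intro κ y hy
    have hball := hsel (corner frame0 m (gridIdx κ)) (hcorner κ)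
    refine hball (mem_ball.2 ?_)
    rw [dist_eq_norm]
    exact lt_of_le_of_lt (Torus.norm_sub_le_of_mem_latticeCell hm (corner_mem_latticeCell hm κ) hy) hmesh
  have hQM : ∀ κ y, ‖Packet.field (Q κ) y‖ ≤ M := fun κ y => hMt _ (sel (corner frame0 m κ)).2 y
  set W : UnitAddTorus d → State d := gridField hm Q with hW
  refine ⟨W, isSmooth_gridField hm hQsupp, isTorusSub_gridField hm hQsupp, fun x => ?_, fun a => ?_, ?_, ?_⟩
  · -- membership `w x + W x ∈ 𝒰_{e x}`
    set y := Torus.repr x with hy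
    have hyU : y ∈ Torus.unitCube d := Torus.repr_mem_unitCube x
    have hxy : Torus.proj y = x := Torus.proj_repr x
    obtain ⟨κ, hyκ⟩ : ∃ κ : d → Fin m, y ∈ Torus.latticeCell m (gridIdx κ) := by
      have := Torus.unitCube_eq_iUnion_latticeCell (d := d) hm ▸ hyU
      rw [mem_iUnion] at this
      exact this
    set a := sel (corner frame0 m (gridIdx κ)) with ha
    have hxO : x ∈ O a := hxy ▸ hcellO κ y hyκ
    obtain ⟨hex, hwx, -⟩ := hxO
    have hadm : IsAdm (w x + W x) := (hw.isAdm x).add (isAdm_gridField hm hQsupp x)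
    have hWx : W x = Packet.field (gridPacket hm Q) y := by rw [hW, ← hxy, gridField_proj hm hQsupp hyU]
    by_cases hyo : y ∈ Torus.latticeCellInterior m (gridIdx κ)
    · have hval : W x = Packet.field (Pk a) ((m : ℝ) • (y - corner frame0 m (gridIdx κ))) := by
        rw [hWx, field_gridPacket_of_mem hm hQsupp hyo]
      refine hPk_marg a (e x) _ (by linarith [hδk a]) hadm ((m : ℝ) • (y - corner frame0 m (gridIdx κ))) ?_
      rw [hval, dist_eq_norm, add_sub_add_right_eq_sub, ← dist_eq_norm]
      linarith [hδk a]
    · have hval : W x = 0 := by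
        rw [hWx]
        refine field_gridPacket_eq_zero hm hQsupp fun κ' hκ' => ?_
        by_cases hκκ : κ' = κ
        · exact hyo (hκκ ▸ hκ')
        · exact (Torus.disjoint_latticeCell hm (gridIdx_injective.ne hκκ)).ne_of_mem
            (Torus.latticeCellInterior_subset hκ') hyκ rfl
      refine hPk_marg0 a (e x) _ (by linarith [hδk a]) hadm ?_
      rw [hval, add_zero]
      linarith [hδk a]
  · -- near-orthogonality
    have hpc : Continuous (p a) := hp a
    have h := abs_integral_inner_gridField_le hm hQsupp hM0 hQM hpc fun c κ y hy y' hy' =>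
      hm₂ (a, c) m (hm_ge₂ (a, c)) κ y hy y' hy'
    refine h.trans ?_
    have hden : 0 < (Fintype.card (Idx d) : ℝ) * M + 1 := by positivity
    calc (Fintype.card (Idx d) : ℝ) * (M * η) = ε * ((Fintype.card (Idx d) : ℝ) * M / ((Fintype.card (Idx d) : ℝ) * M + 1)) := by
          rw [hη]; ring
      _ ≤ ε * 1 := by
          refine mul_le_mul_of_nonneg_left ?_ hε.le
          rw [div_le_one hden]; linarith
      _ = ε := mul_one ε
  · -- the `H⁻¹` bound
    have hVc : Continuous fun x => vel (W x) := continuous_vel.comp (Packet.continuous_tfield (suppIn_gridPacket hm hQsupp))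
    have h0 : ∀ i, ∀ κ : d → Fin m, ∫ y in Torus.latticeCell m (fun i => ((κ i : ℕ) : ℤ)), vel (W (Torus.proj y)) i = 0 :=
      fun i κ => by
        simp only [vel_apply]
        exact setIntegral_cell_gridField_apply hm hQsupp κ (Sum.inl i)
    have hVM : ∀ x, ‖vel (W x)‖ ≤ M := fun x => (norm_vel_le _).trans (norm_gridField_le hm hQsupp hM0 hQM x)
    refine (Torus.eSobolevNorm_neg_one_complexify_le_of_cellwise hVc hm h0 hVM).trans ?_
    set Cd : ℝ := 2 * Real.pi * Real.sqrt (Fintype.card d) * 2 ^ ((Fintype.card d : ℝ) / 2) with hCd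
    rw [card_rpow_half, Torus.hNegConst_eq]
    have hCm : 0 ≤ Cd / m := div_nonneg hCd0 hm'.le
    calc ENNReal.ofReal (Real.sqrt (Fintype.card d)) * (ENNReal.ofReal (Cd / m) * ENNReal.ofReal M)
        = ENNReal.ofReal (Real.sqrt (Fintype.card d) * (Cd / m * M)) := by
          rw [← ENNReal.ofReal_mul hCm, ← ENNReal.ofReal_mul (Real.sqrt_nonneg _)]
      _ ≤ ENNReal.ofReal ε := by
          refine ENNReal.ofReal_le_ofReal ?_
          have h1 : Real.sqrt (Fintype.card d) * Cd * M / ε < m := lt_of_lt_of_le hm₃ (by exact_mod_cast hm_ge₃)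
          rw [div_lt_iff₀ hε] at h1
          rw [show Real.sqrt (Fintype.card d) * (Cd / m * M) = Real.sqrt (Fintype.card d) * Cd * M / m by ring,
            div_le_iff₀ hm']
          linarith
  · -- the gain
    have hcell_gain : ∀ κ : d → Fin m,
        g (sel (corner frame0 m (gridIdx κ))) - ε / 4 ≤ ∫ y, ‖Packet.field (Q (gridIdx κ)) y‖ ^ 2 := fun κ =>
      hPk_gain _
    -- `∫ ‖W‖² = Σ_κ m^{-d} ∫ ‖Q_κ‖²`
    rw [hW, integral_sq_gridField hm hQsupp]
    -- the defect as a sum over cells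
    have hdef : defect e w = ∑ κ : d → Fin m, ∫ y in Torus.latticeCell m (gridIdx κ), g (Torus.proj y) :=
      integral_eq_sum_cells hm hgc
    have hvol : ∀ κ : d → Fin m, volume.real (Torus.latticeCell m (gridIdx κ)) = ((m : ℝ)⁻¹) ^ Fintype.card d := fun κ => by
      rw [measureReal_def, Torus.volume_latticeCell hm, ENNReal.toReal_pow, ENNReal.toReal_ofReal (inv_nonneg.2 hm'.le)]
    have hcell_def : ∀ κ : d → Fin m, ∫ y in Torus.latticeCell m (gridIdx κ), g (Torus.proj y) ≤
        ((m : ℝ)⁻¹) ^ Fintype.card d * (g (sel (corner frame0 m (gridIdx κ))) + ε / 4) := by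
      intro κ
      have hint : IntegrableOn (fun y => g (Torus.proj y)) (Torus.latticeCell m (gridIdx κ)) volume :=
        (Torus.integrableOn_unitCube_of_continuous (hgc.comp Torus.continuous_proj)).mono_set
          (Torus.latticeCell_subset_unitCube hm κ)
      calc ∫ y in Torus.latticeCell m (gridIdx κ), g (Torus.proj y)
          ≤ ∫ y in Torus.latticeCell m (gridIdx κ), (g (sel (corner frame0 m (gridIdx κ))) + ε / 4) := by
            refine setIntegral_mono_on hint (integrableOn_const (Torus.volume_latticeCell_ne_top hm))
              Torus.measurableSet_latticeCell fun y hy => ?_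
            have := (hcellO κ y hy).2.2
            linarith [(abs_lt.1 this).2]
        _ = ((m : ℝ)⁻¹) ^ Fintype.card d * (g (sel (corner frame0 m (gridIdx κ))) + ε / 4) := by
            rw [setIntegral_const, hvol, smul_eq_mul]
    have hcount : ∑ _κ : d → Fin m, ((m : ℝ)⁻¹) ^ Fintype.card d = 1 := by
      rw [Finset.sum_const, Finset.card_univ, Fintype.card_fun, Fintype.card_fin, nsmul_eq_mul, Nat.cast_pow, inv_pow,
        mul_inv_cancel₀ (pow_ne_zero _ hm'.ne')]
    calc defect e w - ε ≤ (∑ κ : d → Fin m, ((m : ℝ)⁻¹) ^ Fintype.card d * (g (sel (corner frame0 m (gridIdx κ))) + ε / 4)) - ε := by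
          rw [hdef]; gcongr with κ; exact hcell_def κ
      _ = (∑ κ : d → Fin m, ((m : ℝ)⁻¹) ^ Fintype.card d * (g (sel (corner frame0 m (gridIdx κ))) - ε / 4)) - ε / 2 := by
          have : ∀ κ : d → Fin m, ((m : ℝ)⁻¹) ^ Fintype.card d * (g (sel (corner frame0 m (gridIdx κ))) + ε / 4) =
              ((m : ℝ)⁻¹) ^ Fintype.card d * (g (sel (corner frame0 m (gridIdx κ))) - ε / 4) +
                ((m : ℝ)⁻¹) ^ Fintype.card d * (ε / 2) := fun κ => by ring
          simp_rw [this, Finset.sum_add_distrib, ← Finset.sum_mul, hcount]; ring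
      _ ≤ ∑ κ : d → Fin m, ((m : ℝ)⁻¹) ^ Fintype.card d * ∫ y, ‖Packet.field (Q (gridIdx κ)) y‖ ^ 2 := by
          have : ∑ κ : d → Fin m, ((m : ℝ)⁻¹) ^ Fintype.card d * (g (sel (corner frame0 m (gridIdx κ))) - ε / 4) ≤
              ∑ κ : d → Fin m, ((m : ℝ)⁻¹) ^ Fintype.card d * ∫ y, ‖Packet.field (Q (gridIdx κ)) y‖ ^ 2 :=
            Finset.sum_le_sum fun κ _ => mul_le_mul_of_nonneg_left (hcell_gain κ) (by positivity)
          linarith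

end StationaryEuler

end Literature.Analysis.FluidPDE
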